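import Mathlib
import HarnessLib
import Literature.Analysis.FluidPDE.ClassicalSolution
import Literature.Analysis.FluidPDE.VectorCalculus
import Summits.NavierStokesRegularity.NavierStokesRegularity.Theorems.UnthreadedRigidityDoorUnthreadedRigidityMixedPairRungs
import Summits.NavierStokesRegularity.NavierStokesRegularity.Theorems.UnthreadedRigidityDoorUnthreadedRigidityVirialHornBridgeWOfInjective
import Summits.NavierStokesRegularity.NavierStokesRegularity.Theorems.UnthreadedRigidityDoorUnthreadedRigidityThreadingJetsWindowGeneric

/-!
# Route `UnthreadedRigidityDoor`, item `UnthreadedRigidity` (W2, stmt-NavierStokesRegularity-27585) — LINE g11-2 «MIXED PAIR»: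
# THE WINDOW ITEMS FROM THE SLICE ITEMS — O-W `PairWindowReduction` and S-HW `HelmholtzWindowDead` are the window bookkeeping (M-part)
# of the slice bridges O2a / O2b / S-H with the pressure decay assumed AT THE LEFT END ONLY

Prover file (engine-1 g72; `--supports stmt-NavierStokesRegularity-27585 --as helper`; route-independent imports).

THE M-PART OF O-W, DISCHARGED.  In an unthreaded window (hypotheses of 27585 verbatim) all of whose slices are admissible pairs over a fixed
axis `a` and a fixed form `Q`, at every time `t ∈ S`:
* `window_sliceData_pair` — there are `T₂ > t` and a pressure `p` with `(u,p)` a classical solution on `[t,T₂)` whose slice `p t` decays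
  at infinity (the pressure gauge `exists_classical_decaying_pressure` of ns-crc-p1 g8 — pair slices are `L⁴`, `memLp_four_pairShell` — restricted
  by `IsClassicalNSSolutionOn.mono`); the threading flux is identically zero on the open window, so `t ↦ F(t,x)` is (trivially) `C²` within
  `[t,∞)` at `t` and ALL its one-sided jets at `t` vanish (`Filter.EventuallyEq.iteratedDerivWithin_eq`, `iteratedDerivWithin_const`) — no jet
  dictionary is needed for this direction;
* `analyticOnNhd_pairProfile_left/right` — every slice is real-analytic (`VirialHorn.window_analyticOnNhd_slice`), and the profiles of an analytic
  PAIR are analytic on `(0,∞)`: the PARITY READ-OFF `⟪u(x₀+y),y⟫ − ⟪u(x₀−y),−y⟫·(−1) …`, precisely `f(y) := ⟪u(x₀ + y), y⟫ = 2H₁(|y|)⟪a,y⟫ +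
  6H₂(|y|)yᵀQy` (`inner_sepShellL_self` twice), `f(re) − f(−re) = 4r⟪a,e⟫H₁(r)`, `f(re) + f(−re) = 12r²(eᵀQe)H₂(r)` with `e = a/|a|`, resp. a unit
  `e` with `eᵀQe ≠ 0` (exists iff `Q ≠ 0`, polarisation; a non-coaxial `Q` is `≠ 0`);
* `isLinked_of_window_slice` — the profiles of every slice of a non-coaxial pair window are LINKED: first-jet silence in the window
  (`VirialHorn.fluxJetOne_eq_zero_of_unthreaded_window`, ns-crc-p2 g8), O1₂ at `(1,2)` and S-L (O1 by name is not even needed).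
CONSEQUENCES.
* ★ `pairWindowReduction_of_sliceBridges : O2a′ → O2b′ → PairWindowReduction` and ★ `helmholtzWindowDead_of_sliceBridge : S-H′ → HelmholtzWindowDead`,
  where `O2a′ / O2b′ / S-H′` are the slice bridges O2a `ObliqueVirialRigidity` / O2b `EquatorialDichotomy` / S-H `HelmholtzPairDead` with their
  pressure-decay clause `∀ t ∈ Ico t₀ T, p t → 0` weakened to `p t₀ → 0` (decay AT `t₀` ONLY — the only instance any slice argument uses, cf.
  `orderTwoVirialIdentity_of_sliceLaw`; the window pressure gauge of record decays at one time), written out as explicit binders (no new `def`);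
  `obliqueVirialRigidity_of_primed`, `equatorialDichotomy_of_primed`, `helmholtzPairDead_of_primed`: the primed forms imply the filed ones;
* ★★ `mixedPairWindowRigidity_of_sliceBridges : O2a′ → O2b′ → S-H′ → MixedPairWindowRigidity` and ★ `mixedPairOrderTwoRigidity_of_sliceBridges :
  O2a′ → O2b′ → S-H′ → MixedPairOrderTwoRigidity` — BOTH RUNGS of LINE g11-2 now rest on EXACTLY the three order-two slice computations.
NOTE FOR THE PLANNER (typed sub-split, not a strike): re-point O2a/O2b/S-H to the primed (decay-at-`t₀`) forms; O-W and S-HW then close by name.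

HONEST LABEL: window bookkeeping of a RUNG line about SPECIAL two-shell data; O2a′/O2b′/S-H′ (the order-two L-computations) remain OPEN
hypotheses; `UnthreadedRigidity` (27585), W2 and NS regularity remain OPEN; nothing here is a statement about Navier–Stokes regularity.  0 kit.
-/

noncomputable section

-- the summit and its single sub-problem share the name (CONVENTIONS §1), as in every Theorems file
set_option linter.dupNamespace false

namespace Summit.NavierStokesRegularity.NavierStokesRegularity.Theorems.UnthreadedRigidity.MixedPair

open scoped Topology InnerProductSpace
open Filter Set MeasureTheory Function
open Literature.Analysis.FluidPDE
open Summit.NavierStokesRegularity.NavierStokesRegularity.Theorems.UnthreadedRigidity.ProfileHorn (E3 threadingFlux IsSliceAxisymmetric)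
open Summit.NavierStokesRegularity.NavierStokesRegularity.Theorems.UnthreadedRigidity.VirialHorn (e det3 vortAmpL VirialAdmissible sepShellL
  IsSolidHarmonic WindowAxisUniform windowAxisUniform_holds memLp_four_sepShellL window_analyticOnNhd_slice fluxJetOne_eq_zero_of_unthreaded_window)
open Summit.NavierStokesRegularity.NavierStokesRegularity.Theorems.UnthreadedRigidity.CoZonal (twoShellL linkAmp twoShellSliceOrderOneIdentity_holds)
open Summit.NavierStokesRegularity.NavierStokesRegularity.Theorems.UnthreadedRigidity.ThreadingJets (fluxJetOne inner_sepShellL_self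
  exists_classical_decaying_pressure)

/-! ### 1. The parity read-off: profiles of an analytic pair are analytic off the origin -/

section ReadOff

variable {H₁ H₂ : ℝ → ℝ} {a : E3} {Q : E3 →L[ℝ] E3} {x₀ : E3}

/-- THE RADIAL READ-OFF OF A PAIR: `⟪u(x₀ + y), y⟫ = 2H₁(|y|)⟪a,y⟫ + 6H₂(|y|)⟪Qy,y⟫`. -/
theorem inner_pairShell_self (hadm : PairAdmissible H₁ H₂ a Q) (x₀ y : E3) :
    inner ℝ (pairShell H₁ H₂ a Q x₀ (x₀ + y)) y = 2 * (H₁ ‖y‖ * ⟪a, y⟫_ℝ) + 6 * (H₂ ‖y‖ * ⟪Q y, y⟫_ℝ) := by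
  obtain ⟨_, hQ, hH₁, hH₂⟩ := hadm
  have h1 := inner_sepShellL_self le_rfl (isSolidHarmonic_dipoleHarmonic a) hH₁ x₀ y
  have h2 := inner_sepShellL_self (by norm_num : 1 ≤ 2) (isSolidHarmonic_quadHarmonic hQ) hH₂ x₀ y
  show inner ℝ (sepShellL H₁ (dipoleHarmonic a) x₀ (x₀ + y) + sepShellL H₂ (quadHarmonic Q) x₀ (x₀ + y)) y = _
  rw [inner_add_left, h1, h2]
  simp only [dipoleHarmonic, quadHarmonic]
  push_cast
  ring

/-- the read-off along a ray `r ↦ ⟪u(x₀ + r e), r e⟫` is real-analytic in `r` when the slice is real-analytic. -/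
theorem analyticAt_rayReadOff {v : E3 → E3} (hv : AnalyticOnNhd ℝ v univ) (x₀ e : E3) (r : ℝ) :
    AnalyticAt ℝ (fun r : ℝ => inner ℝ (v (x₀ + r • e)) (r • e)) r := by
  have h1 : AnalyticAt ℝ (fun r : ℝ => x₀ + r • e) r := analyticAt_const.add (analyticAt_id.smul analyticAt_const)
  have h2 : AnalyticAt ℝ (fun r : ℝ => v (x₀ + r • e)) r := (hv _ (mem_univ _)).comp h1
  have h3 : AnalyticAt ℝ (fun r : ℝ => inner ℝ e (v (x₀ + r • e))) r := (innerSL ℝ e).analyticAt _ |>.comp h2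
  have hfun : (fun r : ℝ => inner ℝ (v (x₀ + r • e)) (r • e)) = fun r : ℝ => r * inner ℝ e (v (x₀ + r • e)) := by
    funext r
    rw [real_inner_smul_right, real_inner_comm]
  rw [hfun]
  exact analyticAt_id.mul h3

/-- ODD PART: `f(re) − f(−re) = 4 r ⟪a,e⟫ H₁(r)` for `r > 0`, `|e| = 1`. -/
theorem pair_readOff_odd (hadm : PairAdmissible H₁ H₂ a Q) (x₀ : E3) {e : E3} (he : ‖e‖ = 1) {r : ℝ} (hr : 0 < r) :
    inner ℝ (pairShell H₁ H₂ a Q x₀ (x₀ + r • e)) (r • e) - inner ℝ (pairShell H₁ H₂ a Q x₀ (x₀ + (-r) • e)) ((-r) • e)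
      = 4 * r * ⟪a, e⟫_ℝ * H₁ r := by
  rw [inner_pairShell_self hadm, inner_pairShell_self hadm]
  have hn1 : ‖r • e‖ = r := by rw [norm_smul, Real.norm_of_nonneg hr.le, he, mul_one]
  have hn2 : ‖(-r) • e‖ = r := by rw [norm_smul, Real.norm_eq_abs, abs_neg, abs_of_pos hr, he, mul_one]
  rw [hn1, hn2]
  simp only [map_smul, map_neg, inner_smul_right, inner_smul_left, inner_neg_right, inner_neg_left, neg_smul, RCLike.conj_to_real]
  ring

/-- EVEN PART: `f(re) + f(−re) = 12 r² ⟪Qe,e⟫ H₂(r)` for `r > 0`, `|e| = 1`. -/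
theorem pair_readOff_even (hadm : PairAdmissible H₁ H₂ a Q) (x₀ : E3) {e : E3} (he : ‖e‖ = 1) {r : ℝ} (hr : 0 < r) :
    inner ℝ (pairShell H₁ H₂ a Q x₀ (x₀ + r • e)) (r • e) + inner ℝ (pairShell H₁ H₂ a Q x₀ (x₀ + (-r) • e)) ((-r) • e)
      = 12 * r ^ 2 * ⟪Q e, e⟫_ℝ * H₂ r := by
  rw [inner_pairShell_self hadm, inner_pairShell_self hadm]
  have hn1 : ‖r • e‖ = r := by rw [norm_smul, Real.norm_of_nonneg hr.le, he, mul_one]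
  have hn2 : ‖(-r) • e‖ = r := by rw [norm_smul, Real.norm_eq_abs, abs_neg, abs_of_pos hr, he, mul_one]
  rw [hn1, hn2]
  simp only [map_smul, map_neg, inner_smul_right, inner_smul_left, inner_neg_right, inner_neg_left, neg_smul, RCLike.conj_to_real]
  ring

/-- ★ THE DIPOLE PROFILE OF AN ANALYTIC PAIR IS ANALYTIC on `(0,∞)` (read off along the axis `e = a/|a|`). -/
theorem analyticOnNhd_pairProfile_left (hadm : PairAdmissible H₁ H₂ a Q) (x₀ : E3)
    (hu : AnalyticOnNhd ℝ (pairShell H₁ H₂ a Q x₀) univ) : AnalyticOnNhd ℝ H₁ (Ioi 0) := by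
  have ha : a ≠ 0 := hadm.1
  have hn : 0 < ‖a‖ := norm_pos_iff.2 ha
  set e : E3 := ‖a‖⁻¹ • a with he_def
  have he : ‖e‖ = 1 := by
    rw [he_def, norm_smul, Real.norm_of_nonneg (inv_nonneg.2 hn.le), inv_mul_cancel₀ hn.ne']
  have hae : ⟪a, e⟫_ℝ = ‖a‖ := by
    rw [he_def, inner_smul_right, real_inner_self_eq_norm_sq]
    field_simp
  set φ : ℝ → ℝ := fun r => inner ℝ (pairShell H₁ H₂ a Q x₀ (x₀ + r • e)) (r • e)
    - inner ℝ (pairShell H₁ H₂ a Q x₀ (x₀ + (-r) • e)) ((-r) • e) with hφ_def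
  have hφ : ∀ r : ℝ, AnalyticAt ℝ φ r := fun r => by
    have h1 := analyticAt_rayReadOff hu x₀ e r
    have h2 : AnalyticAt ℝ (fun r : ℝ => inner ℝ (pairShell H₁ H₂ a Q x₀ (x₀ + (-r) • e)) ((-r) • e)) r :=
      (analyticAt_rayReadOff hu x₀ e (-r)).comp analyticAt_id.neg
    exact h1.sub h2
  intro r hr
  have hr0 : (0 : ℝ) < r := hr
  have hev : (fun s : ℝ => φ s / (4 * s * ‖a‖)) =ᶠ[𝓝 r] H₁ := by
    filter_upwards [Ioi_mem_nhds hr0] with s hs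
    have hs0 : (0 : ℝ) < s := hs
    rw [hφ_def]
    simp only
    rw [pair_readOff_odd hadm x₀ he hs0, hae]
    field_simp
  refine AnalyticAt.congr ?_ hev
  exact (hφ r).div ((analyticAt_const.mul analyticAt_id).mul analyticAt_const)
    (mul_ne_zero (mul_ne_zero (by norm_num) hr0.ne') hn.ne')

/-- a nonzero symmetric `Q` has a unit vector with `⟪Qe,e⟫ ≠ 0` (polarisation). -/
theorem exists_unit_quadHarmonic_ne_zero (hQ : ∀ v w : E3, ⟪Q v, w⟫_ℝ = ⟪v, Q w⟫_ℝ) (hQ0 : Q ≠ 0) :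
    ∃ e : E3, ‖e‖ = 1 ∧ ⟪Q e, e⟫_ℝ ≠ 0 := by
  by_contra h
  push Not at h
  -- the form vanishes on unit vectors, hence everywhere (homogeneity), hence `Q = 0` (polarisation)
  have hall : ∀ y : E3, ⟪Q y, y⟫_ℝ = 0 := by
    intro y
    by_cases hy : y = 0
    · simp [hy]
    · have hn : 0 < ‖y‖ := norm_pos_iff.2 hy
      have he : ‖(‖y‖⁻¹ • y : E3)‖ = 1 := by
        rw [norm_smul, Real.norm_of_nonneg (inv_nonneg.2 hn.le), inv_mul_cancel₀ hn.ne']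
      have h0 := h _ he
      rw [map_smul, inner_smul_left, inner_smul_right, RCLike.conj_to_real] at h0
      have hi : (‖y‖⁻¹ : ℝ) ≠ 0 := inv_ne_zero hn.ne'
      rcases mul_eq_zero.mp h0 with h0 | h0
      · exact absurd h0 hi
      rcases mul_eq_zero.mp h0 with h0 | h0
      · exact absurd h0 hi
      · exact h0
  apply hQ0
  ext v
  have hvw : ∀ w : E3, ⟪Q v, w⟫_ℝ = 0 := by
    intro w
    have h1 := hall (v + w)
    rw [map_add, inner_add_left, inner_add_right, inner_add_right, hall v, hall w, hQ w v, real_inner_comm (Q v) w] at h1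
    linarith
  have := hvw (Q v)
  rw [real_inner_self_eq_norm_sq] at this
  have hq : Q v = 0 := by
    have : ‖Q v‖ = 0 := by nlinarith [norm_nonneg (Q v)]
    exact norm_eq_zero.mp this
  simp [hq]

/-- ★ THE QUADRUPOLE PROFILE OF AN ANALYTIC PAIR IS ANALYTIC on `(0,∞)` when `Q ≠ 0` (read off along a unit `e` with `⟪Qe,e⟫ ≠ 0`). -/
theorem analyticOnNhd_pairProfile_right (hadm : PairAdmissible H₁ H₂ a Q) (hQ0 : Q ≠ 0) (x₀ : E3)
    (hu : AnalyticOnNhd ℝ (pairShell H₁ H₂ a Q x₀) univ) : AnalyticOnNhd ℝ H₂ (Ioi 0) := by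
  obtain ⟨e, he, hQe⟩ := exists_unit_quadHarmonic_ne_zero hadm.2.1.1 hQ0
  set φ : ℝ → ℝ := fun r => inner ℝ (pairShell H₁ H₂ a Q x₀ (x₀ + r • e)) (r • e)
    + inner ℝ (pairShell H₁ H₂ a Q x₀ (x₀ + (-r) • e)) ((-r) • e) with hφ_def
  have hφ : ∀ r : ℝ, AnalyticAt ℝ φ r := fun r => by
    have h1 := analyticAt_rayReadOff hu x₀ e r
    have h2 : AnalyticAt ℝ (fun r : ℝ => inner ℝ (pairShell H₁ H₂ a Q x₀ (x₀ + (-r) • e)) ((-r) • e)) r :=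
      (analyticAt_rayReadOff hu x₀ e (-r)).comp analyticAt_id.neg
    exact h1.add h2
  intro r hr
  have hr0 : (0 : ℝ) < r := hr
  have hev : (fun s : ℝ => φ s / (12 * s ^ 2 * ⟪Q e, e⟫_ℝ)) =ᶠ[𝓝 r] H₂ := by
    filter_upwards [Ioi_mem_nhds hr0] with s hs
    have hs0 : (0 : ℝ) < s := hs
    rw [hφ_def]
    simp only
    rw [pair_readOff_even hadm x₀ he hs0]
    field_simp
  refine AnalyticAt.congr ?_ hev
  exact (hφ r).div ((analyticAt_const.mul (analyticAt_id.pow 2)).mul analyticAt_const)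
    (mul_ne_zero (mul_ne_zero (by norm_num) (pow_ne_zero 2 hr0.ne')) hQe)

/-- a non-coaxial form is nonzero. -/
theorem ne_zero_of_not_isCoaxial (h : ¬ IsCoaxial a Q) : Q ≠ 0 := by
  rintro rfl
  apply h
  intro y
  simp [det3]

end ReadOff

/-! ### 2. The slice data of a pair window at an interior time -/

section SliceData

variable {S : Set ℝ} {u : ℝ → E3 → E3} {x₀ : E3}

/-- THE FLUX OF AN UNTHREADED WINDOW IS EVENTUALLY ZERO near every interior time, WITHIN any set. -/
theorem threadingFlux_eventuallyEq_zero (hS : IsOpen S) (hunth : ∀ t ∈ S, ∀ x, inner ℝ (curl (u t) x) (x - x₀) = 0)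
    {t : ℝ} (ht : t ∈ S) (x : E3) (s : Set ℝ) :
    (fun τ => threadingFlux u x₀ τ x) =ᶠ[𝓝[s] t] fun _ => (0 : ℝ) := by
  apply Filter.Eventually.filter_mono nhdsWithin_le_nhds
  filter_upwards [hS.mem_nhds ht] with τ hτ
  exact hunth τ hτ x

/-- … so it is `Cⁿ` within `[t,∞)` at `t`, … -/
theorem contDiffWithinAt_threadingFlux_of_unthreaded (hS : IsOpen S)
    (hunth : ∀ t ∈ S, ∀ x, inner ℝ (curl (u t) x) (x - x₀) = 0) {t : ℝ} (ht : t ∈ S) (x : E3) (n : WithTop ℕ∞) :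
    ContDiffWithinAt ℝ n (fun τ => threadingFlux u x₀ τ x) (Ici t) t :=
  (contDiffWithinAt_const (c := (0 : ℝ))).congr_of_eventuallyEq (threadingFlux_eventuallyEq_zero hS hunth ht x _) (hunth t ht x)

/-- … and all its one-sided jets at `t` of positive order vanish. -/
theorem iteratedDerivWithin_threadingFlux_of_unthreaded (hS : IsOpen S)
    (hunth : ∀ t ∈ S, ∀ x, inner ℝ (curl (u t) x) (x - x₀) = 0) {t : ℝ} (ht : t ∈ S) (x : E3) {k : ℕ} (hk : k ≠ 0) :
    iteratedDerivWithin k (fun τ => threadingFlux u x₀ τ x) (Ici t) t = 0 := by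
  rw [(threadingFlux_eventuallyEq_zero hS hunth ht x (Ici t)).iteratedDerivWithin_eq (hunth t ht x), iteratedDerivWithin_const, if_neg hk]

/-- ★ THE SLICE DATA OF A PAIR WINDOW: at every time `t` of an unthreaded window all of whose slices are admissible pairs there are `T₂ > t` and a
pressure `p` with `(u,p)` classical on `[t,T₂)` and `p t → 0` at infinity (pressure gauge of a window with `L⁴` slices, restricted). -/
theorem window_sliceData_pair (hS : IsOpen S)
    (hcont : ContinuousOn (Function.uncurry u) (S ×ˢ Set.univ))
    (hdiv : ∀ t ∈ S, VectorCalculus.IsDivFree (u t))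
    (hmild : ∀ s ∈ S, ∀ t ∈ S, s < t → ∀ x, u t x =
        Literature.Analysis.UnboundedOperators.heatExtension (u s) (t - s) x - oseenDuhamel 1 s u u t x)
    (hbdd : ∀ τ ∈ S, ∃ B : ℝ, ∀ t ∈ S, t ≤ τ → ∀ x, ‖u t x‖ ≤ B)
    {a : E3} {Q : E3 →L[ℝ] E3} {H₁f H₂f : ℝ → ℝ → ℝ}
    (hslice : ∀ t ∈ S, PairAdmissible (H₁f t) (H₂f t) a Q ∧ u t = pairShell (H₁f t) (H₂f t) a Q x₀) {t : ℝ} (ht : t ∈ S) :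
    ∃ T₂ : ℝ, t < T₂ ∧ ∃ p : ℝ → E3 → ℝ, IsClassicalNSSolutionOn (Ico t T₂) 1 0 u p ∧ Tendsto (p t) (cocompact E3) (𝓝 0) := by
  have h4 : ∀ τ ∈ S, MemLp (u τ) 4 volume := fun τ hτ => by
    rw [(hslice τ hτ).2]; exact memLp_four_pairShell (hslice τ hτ).1 x₀
  obtain ⟨s, T₂, hst, htT, _, p, hcl, hdec⟩ := exists_classical_decaying_pressure hS hcont hdiv hmild hbdd h4 ht
  exact ⟨T₂, htT, p, hcl.mono (Ico_subset_Ioo_left hst) (uniqueDiffOn_Ico t T₂), hdec⟩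

/-- ★ THE PROFILES OF A NON-COAXIAL PAIR WINDOW ARE LINKED at every time: first-jet silence in the window
(`fluxJetOne_eq_zero_of_unthreaded_window`), O1₂ at degrees `(1,2)` and S-L. -/
theorem isLinked_of_window_slice (hS : IsOpen S)
    (hcont : ContinuousOn (Function.uncurry u) (S ×ˢ Set.univ))
    (hdiv : ∀ t ∈ S, VectorCalculus.IsDivFree (u t))
    (hmild : ∀ s ∈ S, ∀ t ∈ S, s < t → ∀ x, u t x =
        Literature.Analysis.UnboundedOperators.heatExtension (u s) (t - s) x - oseenDuhamel 1 s u u t x)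
    (hbdd : ∀ τ ∈ S, ∃ B : ℝ, ∀ t ∈ S, t ≤ τ → ∀ x, ‖u t x‖ ≤ B)
    (hunth : ∀ t ∈ S, ∀ x, inner ℝ (curl (u t) x) (x - x₀) = 0)
    {a : E3} {Q : E3 →L[ℝ] E3} {H₁ H₂ : ℝ → ℝ} (hadm : PairAdmissible H₁ H₂ a Q) (hnco : ¬ IsCoaxial a Q)
    {t : ℝ} (ht : t ∈ S) (hu : u t = pairShell H₁ H₂ a Q x₀) : IsLinked H₁ H₂ := by
  have hQ := hadm.2.1
  have hH₁ := hadm.2.2.1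
  have hH₂ := hadm.2.2.2
  refine orderOneSilenceLinks_holds H₁ H₂ a Q hadm hnco fun y => ?_
  by_cases hy : y = 0
  · subst hy; simp [det3]
  have h0 := fluxJetOne_eq_zero_of_unthreaded_window hS hcont hdiv hmild hbdd hunth ht (x₀ + y)
  rw [hu, pairShell_eq_twoShellL,
    twoShellSliceOrderOneIdentity_holds 1 2 H₁ H₂ (dipoleHarmonic a) (quadHarmonic Q) x₀ le_rfl (by norm_num)
      (isSolidHarmonic_dipoleHarmonic a) (isSolidHarmonic_quadHarmonic hQ) hH₁ hH₂ y hy,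
    pbr_dipoleHarmonic_quadHarmonic hQ.1, linkAmp] at h0
  push_cast at h0
  linear_combination (-1/4 : ℝ) * h0

end SliceData

/-! ### 3. O-W and S-HW from the primed slice bridges; both rungs from three slice computations -/

section Reduction

/-! The PRIMED slice bridges (pressure decay at `t₀` only), as section hypotheses. -/

variable
  (hOb : ∀ (t₀ T : ℝ) (u : ℝ → E3 → E3) (p : ℝ → E3 → ℝ) (x₀ a : E3) (Q : E3 →L[ℝ] E3) (H₁ H₂ : ℝ → ℝ),
    t₀ < T → IsClassicalNSSolutionOn (Set.Ico t₀ T) 1 0 u p → Tendsto (p t₀) (cocompact E3) (𝓝 0) →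
    (∀ x : E3, ContDiffWithinAt ℝ 2 (fun t => threadingFlux u x₀ t x) (Set.Ici t₀) t₀) →
    PairAdmissible H₁ H₂ a Q → IsOblique a Q → u t₀ = pairShell H₁ H₂ a Q x₀ → AnalyticOnNhd ℝ H₂ (Set.Ioi 0) →
    (∀ x : E3, iteratedDerivWithin 2 (fun t => threadingFlux u x₀ t x) (Set.Ici t₀) t₀ = 0) → IsNullProfile H₂)
  (hEq : ∀ (t₀ T : ℝ) (u : ℝ → E3 → E3) (p : ℝ → E3 → ℝ) (x₀ a : E3) (Q : E3 →L[ℝ] E3) (H₁ H₂ : ℝ → ℝ),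
    t₀ < T → IsClassicalNSSolutionOn (Set.Ico t₀ T) 1 0 u p → Tendsto (p t₀) (cocompact E3) (𝓝 0) →
    (∀ x : E3, ContDiffWithinAt ℝ 2 (fun t => threadingFlux u x₀ t x) (Set.Ici t₀) t₀) →
    PairAdmissible H₁ H₂ a Q → IsEquatorial a Q → ¬ IsCoaxial a Q → u t₀ = pairShell H₁ H₂ a Q x₀ →
    AnalyticOnNhd ℝ H₁ (Set.Ioi 0) → AnalyticOnNhd ℝ H₂ (Set.Ioi 0) → IsLinked H₁ H₂ →
    (∀ x : E3, iteratedDerivWithin 2 (fun t => threadingFlux u x₀ t x) (Set.Ici t₀) t₀ = 0) →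
    IsNullProfile H₁ ∨ IsNullProfile H₂ ∨ IsHelmholtzLinked H₁ H₂)
  (hH : ∀ (t₀ T : ℝ) (u : ℝ → E3 → E3) (p : ℝ → E3 → ℝ) (x₀ a : E3) (Q : E3 →L[ℝ] E3) (H₁ H₂ : ℝ → ℝ),
    t₀ < T → IsClassicalNSSolutionOn (Set.Ico t₀ T) 1 0 u p → Tendsto (p t₀) (cocompact E3) (𝓝 0) →
    (∀ x : E3, ContDiffWithinAt ℝ 2 (fun t => threadingFlux u x₀ t x) (Set.Ici t₀) t₀) →
    PairAdmissible H₁ H₂ a Q → ¬ IsCoaxial a Q → u t₀ = pairShell H₁ H₂ a Q x₀ → IsHelmholtzLinked H₁ H₂ →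
    (∀ x : E3, iteratedDerivWithin 2 (fun t => threadingFlux u x₀ t x) (Set.Ici t₀) t₀ = 0) →
    IsNullProfile H₁ ∨ IsNullProfile H₂)

include hOb in
/-- O2a′ ⇒ O2a `ObliqueVirialRigidity` (the primed form assumes decay at `t₀` only). -/
theorem obliqueVirialRigidity_of_primed : ObliqueVirialRigidity :=
  fun t₀ T u p x₀ a Q H₁ H₂ hT hsol hp hcd hadm hob hu hA hj =>
    hOb t₀ T u p x₀ a Q H₁ H₂ hT hsol (hp t₀ ⟨le_rfl, hT⟩) hcd hadm hob hu hA hj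

include hEq in
/-- O2b′ ⇒ O2b `EquatorialDichotomy`. -/
theorem equatorialDichotomy_of_primed : EquatorialDichotomy :=
  fun t₀ T u p x₀ a Q H₁ H₂ hT hsol hp hcd hadm heq hnco hu hA1 hA2 hl hj =>
    hEq t₀ T u p x₀ a Q H₁ H₂ hT hsol (hp t₀ ⟨le_rfl, hT⟩) hcd hadm heq hnco hu hA1 hA2 hl hj

include hH in
/-- S-H′ ⇒ S-H `HelmholtzPairDead`. -/
theorem helmholtzPairDead_of_primed : HelmholtzPairDead :=
  fun t₀ T u p x₀ a Q H₁ H₂ hT hsol hp hcd hadm hnco hu hhl hj =>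
    hH t₀ T u p x₀ a Q H₁ H₂ hT hsol (hp t₀ ⟨le_rfl, hT⟩) hcd hadm hnco hu hhl hj

include hOb hEq in
/-- ★ **O-W `PairWindowReduction` FROM THE PRIMED SLICE BRIDGES O2a′, O2b′** (the M-part of O-W, discharged): at an interior time of a transverse
non-coaxial pair window the slice data (`window_sliceData_pair`), the vanishing one-sided jets, the analytic profiles (parity read-off) and the
linkage (first-jet silence) are exactly the hypotheses of O2b′ (equatorial `Qa = 0`) or O2a′ (oblique `Qa ≠ 0`). -/
theorem pairWindowReduction_of_sliceBridges : PairWindowReduction := by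
  intro S hS u x₀ hcont hdiv hmild hbdd hunth a Q H₁f H₂f htr hnco hslice t ht
  obtain ⟨hadm, hu⟩ := hslice t ht
  obtain ⟨T₂, htT, p, hcl, hdec⟩ := window_sliceData_pair hS hcont hdiv hmild hbdd hslice ht
  have hcd : ∀ x : E3, ContDiffWithinAt ℝ 2 (fun τ => threadingFlux u x₀ τ x) (Ici t) t := fun x =>
    contDiffWithinAt_threadingFlux_of_unthreaded hS hunth ht x 2
  have hj2 : ∀ x : E3, iteratedDerivWithin 2 (fun τ => threadingFlux u x₀ τ x) (Ici t) t = 0 := fun x =>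
    iteratedDerivWithin_threadingFlux_of_unthreaded hS hunth ht x two_ne_zero
  have han : AnalyticOnNhd ℝ (pairShell (H₁f t) (H₂f t) a Q x₀) univ := by
    rw [← hu]; exact window_analyticOnNhd_slice hS hcont hmild hbdd ht
  have hQ0 : Q ≠ 0 := ne_zero_of_not_isCoaxial hnco
  have hA1 : AnalyticOnNhd ℝ (H₁f t) (Ioi 0) := analyticOnNhd_pairProfile_left hadm x₀ han
  have hA2 : AnalyticOnNhd ℝ (H₂f t) (Ioi 0) := analyticOnNhd_pairProfile_right hadm hQ0 x₀ han
  have hlink : IsLinked (H₁f t) (H₂f t) := isLinked_of_window_slice hS hcont hdiv hmild hbdd hunth hadm hnco ht hu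
  by_cases hq : Q a = 0
  · exact hEq t T₂ u p x₀ a Q (H₁f t) (H₂f t) htT hcl hdec hcd hadm hq hnco hu hA1 hA2 hlink hj2
  · exact Or.inr (Or.inl (hOb t T₂ u p x₀ a Q (H₁f t) (H₂f t) htT hcl hdec hcd hadm ⟨htr.1, hq, htr.2 hq⟩ hu hA2 hj2))

include hH in
/-- ★ **S-HW `HelmholtzWindowDead` FROM THE PRIMED SLICE SUPPORT S-H′** (window bookkeeping only). -/
theorem helmholtzWindowDead_of_sliceBridge : HelmholtzWindowDead := by
  intro S hS u x₀ hcont hdiv hmild hbdd hunth a Q H₁f H₂f hnco hslice t ht hhl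
  obtain ⟨hadm, hu⟩ := hslice t ht
  obtain ⟨T₂, htT, p, hcl, hdec⟩ := window_sliceData_pair hS hcont hdiv hmild hbdd hslice ht
  exact hH t T₂ u p x₀ a Q (H₁f t) (H₂f t) htT hcl hdec
    (fun x => contDiffWithinAt_threadingFlux_of_unthreaded hS hunth ht x 2) hadm hnco hu hhl
    (fun x => iteratedDerivWithin_threadingFlux_of_unthreaded hS hunth ht x two_ne_zero)

include hOb hEq hH in
/-- ★★ **THE WINDOW RUNG OF LINE g11-2 FROM THREE SLICE COMPUTATIONS**: `MixedPairWindowRigidity` ⇐ O2a′ ∧ O2b′ ∧ S-H′. -/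
theorem mixedPairWindowRigidity_of_sliceBridges : MixedPairWindowRigidity :=
  mixedPairWindowRigidity_of_reduction (pairWindowReduction_of_sliceBridges hOb hEq) (helmholtzWindowDead_of_sliceBridge hH)

include hOb hEq hH in
/-- ★ **THE SLICE RUNG OF LINE g11-2 FROM THE SAME THREE SLICE COMPUTATIONS**: `MixedPairOrderTwoRigidity` ⇐ O2a′ ∧ O2b′ ∧ S-H′. -/
theorem mixedPairOrderTwoRigidity_of_sliceBridges : MixedPairOrderTwoRigidity :=
  mixedPairOrderTwoRigidity_of_orderTwo (obliqueVirialRigidity_of_primed hOb) (equatorialDichotomy_of_primed hEq)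
    (helmholtzPairDead_of_primed hH)

end Reduction

end Summit.NavierStokesRegularity.NavierStokesRegularity.Theorems.UnthreadedRigidity.MixedPair

end
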